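import Literature.MathematicalPhysics.QuantumFieldTheory.SUNBakryEmeryHeatFlow
import Mathlib.Analysis.Calculus.ParametricIntegral
import Mathlib.Analysis.SpecialFunctions.SmoothTransition
import Mathlib.Analysis.SpecialFunctions.Log.NegMulLog
import Mathlib.Analysis.Calculus.Deriv.Inv
import HarnessLib

/-!
# De Bruijn's identity along polynomial heat flows on `SU(N)`

Second file of the dynamic Bakry–Émery argument for the Haar measure of `SU(N)` (Bakry–Gentil–Ledoux 2014, §5.7,
p. 268–269: `Λ(t) = ∫ P_t f log P_t f dμ`, `Λ' = −I_μ(P_t f)` (de Bruijn, Prop. 5.2.2), `Λ'' = 2∫ P_t f Γ₂(log P_t f) dμ`),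
in the ambient-coordinate calculus of `SUNBakryEmeryPoincare.lean` (`D_α`, `Γ`, `Δ`).  Here:

* second-order chain rule `Δ(ψ∘F) = ψ'(F) ΔF + ψ''(F) Γ(F,F)` and `Γ(ψ∘F, G) = ψ'(F) Γ(F,G)` (`Lap_comp`, `Gam_comp_left`;
  BGL (1.11.4), the diffusion property);
* a smooth global replacement of `log` (`exists_smooth_log_cutoff`: `ψ ∈ C^∞(ℝ)`, `ψ = log` on `(2a, ∞)`), so that
  `log p` of a function `p ≥ δ > 0` on `SU(N)` is the restriction of a globally smooth ambient function and the
  integration-by-parts identities of `SUNBakryEmeryPoincare` apply;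
* differentiation under the Haar integral for jointly continuous derivatives (`hasDerivAt_integral_SUN`);
* linear-combination plumbing for coordinate flows `p_t = ∑ c_i(t) b_i` (`matD_sum_mul`, `hasDerivAt_gam_flow`, …);
* ★ **de Bruijn's identity** `d/dt ∫ p_t log p_t dσ = −∫ Γ(p_t,p_t)/p_t dσ` along a polynomial heat flow which is
  `≥ δ > 0` on `SU(N)` near `t₀` (`hasDerivAt_entropy_flow`; BGL Prop. 5.2.2 / (5.2.3)).

Theorems only; no definition.  The Fisher-information derivative (the `Γ₂` step) and the log-Sobolev inequality are
in the sequel files.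

## References

* D. Bakry, I. Gentil, M. Ledoux, *Analysis and Geometry of Markov Diffusion Operators*, Grundlehren 348 (2014):
  (1.11.4) (diffusion property / chain rule), Prop. 5.2.2 (5.2.3) (de Bruijn's identity), §5.7 p. 268–269.
* D. Bakry, M. Émery, *Diffusions hypercontractives*, LNM 1123 (1985).
-/

noncomputable section

open scoped Matrix ComplexConjugate BigOperators

namespace Literature.MathematicalPhysics.QuantumFieldTheory

namespace SUNBakryEmery

open scoped Matrix.Norms.Frobenius ContDiff Topology
open Matrix Complex Finset MeasureTheory Filter Set Metric

variable {N : ℕ}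

/-! ### Chain rules (diffusion property) -/

/-- `Γ(ψ∘F, G) = ψ'(F) Γ(F, G)` (the diffusion property of the carré du champ, BGL (1.11.3)–(1.11.4)).
[cite: BakryGentilLedoux2014, (1.11.4)] -/
theorem Gam_comp_left {F G : Matrix (Fin N) (Fin N) ℂ → ℝ} (hF : ContDiff ℝ ∞ F) {ψ : ℝ → ℝ}
    (hψ : ContDiff ℝ ∞ ψ) (Q : Matrix (Fin N) (Fin N) ℂ) :
    Gam (fun Q => ψ (F Q)) G Q = deriv ψ (F Q) * Gam F G Q := by
  simp only [Gam, matD_comp hF hψ, mul_sum]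
  exact sum_congr rfl fun α _ => by ring

/-- **Second-order chain rule** `Δ(ψ∘F) = ψ'(F) ΔF + ψ''(F) Γ(F,F)` (the diffusion property of `Δ = ∑_α D_α²`,
BGL (1.11.4)). [cite: BakryGentilLedoux2014, (1.11.4)] -/
theorem Lap_comp {F : Matrix (Fin N) (Fin N) ℂ → ℝ} (hF : ContDiff ℝ ∞ F) {ψ : ℝ → ℝ} (hψ : ContDiff ℝ ∞ ψ)
    (Q : Matrix (Fin N) (Fin N) ℂ) :
    Lap (fun Q => ψ (F Q)) Q = deriv ψ (F Q) * Lap F Q + deriv (deriv ψ) (F Q) * Gam F F Q := by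
  have hψ' : ContDiff ℝ ∞ (deriv ψ) := by
    have := hψ.iterate_deriv 1
    simpa using this
  have hcomp : ContDiff ℝ ∞ fun Q => deriv ψ (F Q) := hψ'.comp hF
  have h1 : ∀ α : FrameIdx N, matD (frame α) (matD (frame α) (fun Q => ψ (F Q))) Q =
      deriv ψ (F Q) * matD (frame α) (matD (frame α) F) Q +
        deriv (deriv ψ) (F Q) * (matD (frame α) F Q * matD (frame α) F Q) := by
    intro α
    rw [matD_comp hF hψ, matD_fun_mul hcomp (contDiff_matD hF _), matD_comp hF hψ']
    ring
  simp only [Lap, Gam, h1, sum_add_distrib, ← mul_sum]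

/-! ### A smooth global replacement of the logarithm -/

/-- **Smooth log cut-off**: for `a > 0` there is `ψ ∈ C^∞(ℝ)` with `ψ(x) = log x`, `ψ'(x) = 1/x`, `ψ''(x) = −1/x²`
for all `x > 2a` (take `ψ = log ∘ η` with `η(x) = a + (x − a)·smoothTransition((x − a)/a) ≥ a`, `η = id` on `[2a, ∞)`).
Used to apply ambient integration by parts to `log p_t` along a positive heat flow (BGL work with `f ∈ 𝒜₀^{const+}` for
the same purpose). [cite: BakryGentilLedoux2014, §3.3 and Prop. 5.2.2 (positive functions bounded below, `𝒜₀^{const+}`; proof device)] -/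
theorem exists_smooth_log_cutoff {a : ℝ} (ha : 0 < a) :
    ∃ ψ : ℝ → ℝ, ContDiff ℝ ∞ ψ ∧ ∀ x, 2 * a < x →
      ψ x = Real.log x ∧ deriv ψ x = x⁻¹ ∧ deriv (deriv ψ) x = -(x ^ 2)⁻¹ := by
  set η : ℝ → ℝ := fun x => a + (x - a) * Real.smoothTransition ((x - a) / a) with hη
  have hηC : ContDiff ℝ ∞ η := by
    refine contDiff_const.add ((contDiff_id.sub contDiff_const).mul ?_)
    exact Real.smoothTransition.contDiff.comp ((contDiff_id.sub contDiff_const).div_const a)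
  have hηpos : ∀ x, 0 < η x := by
    intro x
    by_cases hx : x ≤ a
    · have : Real.smoothTransition ((x - a) / a) = 0 :=
        Real.smoothTransition.zero_of_nonpos (div_nonpos_of_nonpos_of_nonneg (by linarith) ha.le)
      simp only [hη, this, mul_zero, add_zero]
      exact ha
    · push Not at hx
      have h0 := Real.smoothTransition.nonneg ((x - a) / a)
      have : 0 ≤ (x - a) * Real.smoothTransition ((x - a) / a) := mul_nonneg (by linarith) h0
      simp only [hη]
      linarith
  have hηid : ∀ x, 2 * a ≤ x → η x = x := by
    intro x hx
    have : Real.smoothTransition ((x - a) / a) = 1 :=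
      Real.smoothTransition.one_of_one_le (by rw [le_div_iff₀ ha]; linarith)
    simp only [hη, this, mul_one]
    ring
  refine ⟨fun x => Real.log (η x), hηC.log fun x => (hηpos x).ne', fun x hx => ?_⟩
  -- `ψ = log` on the open set `(2a, ∞) ∋ x`
  have hev : (fun x => Real.log (η x)) =ᶠ[𝓝 x] Real.log := by
    filter_upwards [Ioi_mem_nhds hx] with y hy
    rw [hηid y (le_of_lt hy)]
  have hd1 : deriv (fun x => Real.log (η x)) =ᶠ[𝓝 x] deriv Real.log := by
    filter_upwards [hev.eventuallyEq_nhds] with y hy using hy.deriv_eq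
  refine ⟨by show Real.log (η x) = Real.log x; rw [hηid x hx.le], ?_, ?_⟩
  · rw [hev.deriv_eq, Real.deriv_log]
  · rw [hd1.deriv_eq]
    have : deriv Real.log = fun y : ℝ => y⁻¹ := by funext y; exact Real.deriv_log y
    rw [this, deriv_inv]

/-! ### Differentiation under the Haar integral -/

/-- **Differentiation under the integral sign on `SU(N)`** for integrands with jointly continuous derivative on a
compact time-slab: if `F(t,·)` is continuous, `∂_t F = F'` pointwise for `t ∈ [t₀−ε, t₀+ε]`, and `F'` is jointly
continuous on `[t₀−ε,t₀+ε] × SU(N)`, then `d/dt ∫ F(t,g) dσ = ∫ F'(t₀,g) dσ` at `t₀` (dominated differentiation with a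
constant bound from compactness). [cite: BakryGentilLedoux2014, §1.4 and Prop. 5.2.2 (differentiating integrals along the semigroup; proof device)] -/
theorem hasDerivAt_integral_SUN {F F' : ℝ → SUN N → ℝ} {t₀ ε : ℝ} (hε : 0 < ε)
    (hF : ∀ t ∈ Icc (t₀ - ε) (t₀ + ε), Continuous (F t))
    (hF' : ContinuousOn (Function.uncurry F') (Icc (t₀ - ε) (t₀ + ε) ×ˢ univ))
    (hdiff : ∀ t ∈ Icc (t₀ - ε) (t₀ + ε), ∀ g : SUN N, HasDerivAt (fun s => F s g) (F' t g) t) :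
    HasDerivAt (fun t => ∫ g, F t g ∂(haarSU N)) (∫ g, F' t₀ g ∂(haarSU N)) t₀ := by
  have hK : IsCompact (Icc (t₀ - ε) (t₀ + ε) ×ˢ (univ : Set (SUN N))) := isCompact_Icc.prod isCompact_univ
  obtain ⟨C, hC⟩ := hK.exists_bound_of_continuousOn hF'
  have hball : ball t₀ ε ⊆ Icc (t₀ - ε) (t₀ + ε) := fun t ht => by
    rw [Metric.mem_ball, Real.dist_eq] at ht
    constructor <;> linarith [abs_lt.1 ht]
  have ht₀ : t₀ ∈ Icc (t₀ - ε) (t₀ + ε) := ⟨by linarith, by linarith⟩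
  refine (hasDerivAt_integral_of_dominated_loc_of_deriv_le (μ := haarSU N) (F := F) (F' := F') (x₀ := t₀)
    (bound := fun _ => C) (ball_mem_nhds t₀ hε) ?_ ?_ ?_ ?_ ?_ ?_).2
  · filter_upwards [ball_mem_nhds t₀ hε] with t ht using (hF t (hball ht)).aestronglyMeasurable
  · exact integrable_of_continuous_SUN (hF t₀ ht₀) _
  · have : Continuous fun g : SUN N => F' t₀ g :=
      hF'.comp_continuous (Continuous.prodMk_right t₀) fun g => ⟨ht₀, mem_univ _⟩
    exact this.aestronglyMeasurable
  · refine ae_of_all _ fun g t ht => ?_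
    exact hC (t, g) ⟨hball ht, mem_univ _⟩
  · exact integrable_const C
  · exact ae_of_all _ fun g t ht => hdiff t (hball ht) g

/-! ### Coordinate flows `p_t = ∑_i c_i(t) b_i`: derivatives and carré du champ -/

/-- `D_A (∑_i w_i b_i) = ∑_i w_i D_A b_i`. [cite: BakryGentilLedoux2014, §5.7 p. 269 (proof device)] -/
theorem matD_sum_mul {d : ℕ} {b : Fin d → Matrix (Fin N) (Fin N) ℂ → ℝ} (hb : ∀ i, ContDiff ℝ ∞ (b i))
    (w : Fin d → ℝ) (A : Matrix (Fin N) (Fin N) ℂ) :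
    matD A (fun Q => ∑ i, w i * b i Q) = fun Q => ∑ i, w i * matD A (b i) Q := by
  rw [matD_sum univ (F := fun i Q => w i * b i Q) (fun i _ => contDiff_const.mul (hb i))]
  funext Q
  exact sum_congr rfl fun i _ => by rw [matD_const_mul (hb i)]

/-- Time derivative of `t ↦ p_t(Q) = ∑ c_i(t) b_i(Q)`: `∑ c_i'(t) b_i(Q)`. [cite: BakryGentilLedoux2014, §5.7 p. 269 (heat equation ∂_t P_t f = L P_t f; proof device)] -/
theorem hasDerivAt_flow_apply {d : ℕ} (b : Fin d → Matrix (Fin N) (Fin N) ℂ → ℝ) {c c' : ℝ → Fin d → ℝ}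
    (hc : ∀ t i, HasDerivAt (fun s => c s i) (c' t i) t) (t : ℝ) (Q : Matrix (Fin N) (Fin N) ℂ) :
    HasDerivAt (fun s => ∑ i, c s i * b i Q) (∑ i, c' t i * b i Q) t :=
  HasDerivAt.fun_sum fun i _ => (hc t i).mul_const _

/-- Time derivative of `t ↦ D_A p_t(Q)`: `D_A(∑ c_i' b_i)(Q)`. [cite: BakryGentilLedoux2014, §5.7 p. 269 (proof device)] -/
theorem hasDerivAt_matD_flow {d : ℕ} {b : Fin d → Matrix (Fin N) (Fin N) ℂ → ℝ} (hb : ∀ i, ContDiff ℝ ∞ (b i))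
    {c c' : ℝ → Fin d → ℝ} (hc : ∀ t i, HasDerivAt (fun s => c s i) (c' t i) t) (A : Matrix (Fin N) (Fin N) ℂ)
    (t : ℝ) (Q : Matrix (Fin N) (Fin N) ℂ) :
    HasDerivAt (fun s => matD A (fun Q => ∑ i, c s i * b i Q) Q)
      (matD A (fun Q => ∑ i, c' t i * b i Q) Q) t := by
  have e : (fun s => matD A (fun Q => ∑ i, c s i * b i Q) Q) = fun s => ∑ i, c s i * matD A (b i) Q := by
    funext s; rw [matD_sum_mul hb]
  rw [e, matD_sum_mul hb]
  exact HasDerivAt.fun_sum fun i _ => (hc t i).mul_const _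

/-- Time derivative of `t ↦ Γ(p_t,p_t)(Q)`: `2 Γ(p_t, ∂_t p_t)(Q)`. [cite: BakryGentilLedoux2014, §5.7 p. 269 (proof device)] -/
theorem hasDerivAt_gam_flow {d : ℕ} {b : Fin d → Matrix (Fin N) (Fin N) ℂ → ℝ} (hb : ∀ i, ContDiff ℝ ∞ (b i))
    {c c' : ℝ → Fin d → ℝ} (hc : ∀ t i, HasDerivAt (fun s => c s i) (c' t i) t)
    (t : ℝ) (Q : Matrix (Fin N) (Fin N) ℂ) :
    HasDerivAt (fun s => Gam (fun Q => ∑ i, c s i * b i Q) (fun Q => ∑ i, c s i * b i Q) Q)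
      (2 * Gam (fun Q => ∑ i, c t i * b i Q) (fun Q => ∑ i, c' t i * b i Q) Q) t := by
  simp only [Gam, mul_sum]
  refine HasDerivAt.fun_sum fun α _ => ?_
  have h := (hasDerivAt_matD_flow hb hc (frame α) t Q).mul (hasDerivAt_matD_flow hb hc (frame α) t Q)
  exact h.congr_deriv (by ring)

/-- Joint continuity of `(t,g) ↦ ∑ u_i(t) v_i(g)` for continuous `u_i`, `v_i`. [cite: BakryGentilLedoux2014, §5.7 p. 269 (proof device)] -/
theorem continuous_sum_mul_uncurry {d : ℕ} {u : ℝ → Fin d → ℝ} (hu : ∀ i, Continuous fun t => u t i)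
    {v : Fin d → SUN N → ℝ} (hv : ∀ i, Continuous (v i)) :
    Continuous (Function.uncurry fun (t : ℝ) (g : SUN N) => ∑ i, u t i * v i g) :=
  continuous_finsetSum _ fun i _ => ((hu i).comp continuous_fst).mul ((hv i).comp continuous_snd)

/-- Coefficients of a differentiable flow are continuous. [cite: BakryGentilLedoux2014, §5.7 p. 269 (proof device)] -/
theorem continuous_coeff_of_hasDerivAt {d : ℕ} {c c' : ℝ → Fin d → ℝ}
    (hc : ∀ t i, HasDerivAt (fun s => c s i) (c' t i) t) (i : Fin d) : Continuous fun t => c t i :=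
  continuous_iff_continuousAt.2 fun t => (hc t i).continuousAt

/-! ### ★ De Bruijn's identity along a positive polynomial heat flow -/

/-- ★ **De Bruijn's identity** (BGL Prop. 5.2.2, (5.2.3): `d/dt Ent_μ(P_t f) = −I_μ(P_t f)`), for the heat flow on
polynomial functions of `SU(N)`: let `p_t = ∑_i c_i(t) b_i` (smooth ambient `b_i`, differentiable `c_i` with
continuous `c_i'`) solve `Δ p_t = ∑ c_i' b_i = ∂_t p_t`, and assume `p_t ≥ δ > 0` on `SU(N)` for `t ∈ [t₀−ε, t₀+ε]`.
Then `t ↦ ∫ p_t log p_t dσ` is differentiable at `t₀` with derivative `−∫ Γ(p_{t₀},p_{t₀})/p_{t₀} dσ` (the Fisher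
information): `∫ (1 + log p) Δp dσ = −∫ Γ(log p, p) dσ = −∫ Γ(p,p)/p dσ`, where `log p` is replaced by the globally
smooth `ψ∘p` of `exists_smooth_log_cutoff` to integrate by parts. [cite: BakryGentilLedoux2014, Prop. 5.2.2] -/
theorem hasDerivAt_entropy_flow (hN : N ≠ 0) {d : ℕ} {b : Fin d → Matrix (Fin N) (Fin N) ℂ → ℝ}
    (hb : ∀ i, ContDiff ℝ ∞ (b i)) {c c' : ℝ → Fin d → ℝ} (hc : ∀ t i, HasDerivAt (fun s => c s i) (c' t i) t)
    (hc' : ∀ i, Continuous fun t => c' t i)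
    (hheat : ∀ t, Lap (fun Q => ∑ i, c t i * b i Q) = fun Q => ∑ i, c' t i * b i Q)
    {δ t₀ ε : ℝ} (hδ : 0 < δ) (hε : 0 < ε)
    (hpos : ∀ t ∈ Icc (t₀ - ε) (t₀ + ε), ∀ g : SUN N, δ ≤ ∑ i, c t i * b i (g : Matrix (Fin N) (Fin N) ℂ)) :
    HasDerivAt (fun t => ∫ g : SUN N, (∑ i, c t i * b i (g : Matrix (Fin N) (Fin N) ℂ)) *
        Real.log (∑ i, c t i * b i (g : Matrix (Fin N) (Fin N) ℂ)) ∂(haarSU N))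
      (-∫ g : SUN N, Gam (fun Q => ∑ i, c t₀ i * b i Q) (fun Q => ∑ i, c t₀ i * b i Q) g /
        (∑ i, c t₀ i * b i (g : Matrix (Fin N) (Fin N) ℂ)) ∂(haarSU N)) t₀ := by
  -- notation
  set P : ℝ → SUN N → ℝ := fun t g => ∑ i, c t i * b i (g : Matrix (Fin N) (Fin N) ℂ) with hP
  set LP : ℝ → SUN N → ℝ := fun t g => ∑ i, c' t i * b i (g : Matrix (Fin N) (Fin N) ℂ) with hLP
  have hcc : ∀ i, Continuous fun t => c t i := continuous_coeff_of_hasDerivAt hc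
  have hbc : ∀ i, Continuous fun g : SUN N => b i (g : Matrix (Fin N) (Fin N) ℂ) :=
    fun i => continuous_restrict (hb i)
  have hPc : Continuous (Function.uncurry P) := continuous_sum_mul_uncurry hcc hbc
  have hLPc : Continuous (Function.uncurry LP) := continuous_sum_mul_uncurry hc' hbc
  -- 1. differentiate under the integral
  have hmain := hasDerivAt_integral_SUN (N := N) (t₀ := t₀) hε (F := fun t g => P t g * Real.log (P t g))
    (F' := fun t g => (Real.log (P t g) + 1) * LP t g) ?_ ?_ ?_
  rotate_left
  · intro t _
    exact Real.continuous_mul_log.comp (hPc.comp (Continuous.prodMk_right t))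
  · -- joint continuity of `(log P + 1) · LP` on the slab where `P ≥ δ > 0`
    refine ContinuousOn.mul (ContinuousOn.add ?_ continuousOn_const) hLPc.continuousOn
    refine hPc.continuousOn.log fun z hz => ?_
    have := hpos z.1 (mem_prod.1 hz).1 z.2
    exact ne_of_gt (lt_of_lt_of_le hδ this)
  · intro t ht g
    have hne : P t g ≠ 0 := ne_of_gt (lt_of_lt_of_le hδ (hpos t ht g))
    have h1 : HasDerivAt (fun s => P s g) (LP t g) t := hasDerivAt_flow_apply b hc t (g : Matrix (Fin N) (Fin N) ℂ)
    have h2 := (Real.hasDerivAt_mul_log hne).comp t h1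
    simpa [Function.comp_def] using h2
  -- 2. the value of the derivative: `∫ (log p + 1) Δp = −∫ Γ(p,p)/p`
  have hPs : ∀ t, ContDiff ℝ ∞ (fun Q => ∑ i, c t i * b i Q) := fun t => contDiff_sum_mul hb (c t)
  obtain ⟨ψ, hψ, hψlog⟩ := exists_smooth_log_cutoff (a := δ / 4) (by linarith)
  have ht₀ : t₀ ∈ Icc (t₀ - ε) (t₀ + ε) := ⟨by linarith, by linarith⟩
  have hPt₀ : ∀ g : SUN N, 2 * (δ / 4) < P t₀ g := fun g => by
    have := hpos t₀ ht₀ g; simp only [hP]; linarith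
  -- `∫ Δp = 0`
  have hLap0 : ∫ g : SUN N, LP t₀ g ∂(haarSU N) = 0 := by
    have h := integral_Lap hN (hPs t₀)
    rw [hheat t₀] at h
    exact h
  -- `∫ log p · Δp = −∫ Γ(p,p)/p`
  have hIBP : ∫ g : SUN N, Real.log (P t₀ g) * LP t₀ g ∂(haarSU N) =
      -∫ g : SUN N, Gam (fun Q => ∑ i, c t₀ i * b i Q) (fun Q => ∑ i, c t₀ i * b i Q) g / P t₀ g ∂(haarSU N) := by
    have h := integral_mul_Lap hN (hψ.comp (hPs t₀)) (hPs t₀)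
    rw [hheat t₀] at h
    have e1 : ∀ g : SUN N, Real.log (P t₀ g) * LP t₀ g =
        (fun Q => ψ (∑ i, c t₀ i * b i Q)) (g : Matrix (Fin N) (Fin N) ℂ) * ∑ i, c' t₀ i * b i (g : Matrix (Fin N) (Fin N) ℂ) := by
      intro g
      simp only [hP, hLP]
      rw [(hψlog _ (hPt₀ g)).1]
    have e2 : ∀ g : SUN N, Gam (fun Q => ψ (∑ i, c t₀ i * b i Q)) (fun Q => ∑ i, c t₀ i * b i Q) g =
        Gam (fun Q => ∑ i, c t₀ i * b i Q) (fun Q => ∑ i, c t₀ i * b i Q) g / P t₀ g := by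
      intro g
      rw [Gam_comp_left (hPs t₀) hψ, (hψlog _ (hPt₀ g)).2.1, inv_mul_eq_div]
    simp_rw [e1, ← e2]
    exact h
  have hval : ∫ g : SUN N, (Real.log (P t₀ g) + 1) * LP t₀ g ∂(haarSU N) =
      -∫ g : SUN N, Gam (fun Q => ∑ i, c t₀ i * b i Q) (fun Q => ∑ i, c t₀ i * b i Q) g / P t₀ g ∂(haarSU N) := by
    have hlogc : Continuous fun g : SUN N => Real.log (P t₀ g) :=
      (hPc.comp (Continuous.prodMk_right t₀)).log fun g => ne_of_gt (lt_of_lt_of_le hδ (hpos t₀ ht₀ g))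
    have hLPc₀ : Continuous fun g : SUN N => LP t₀ g := hLPc.comp (Continuous.prodMk_right t₀)
    have e : ∀ g : SUN N, (Real.log (P t₀ g) + 1) * LP t₀ g = Real.log (P t₀ g) * LP t₀ g + LP t₀ g := fun g => by ring
    simp_rw [e]
    rw [integral_add (integrable_of_continuous_SUN (φ := fun g => Real.log (P t₀ g) * LP t₀ g) (hlogc.mul hLPc₀) _)
      (integrable_of_continuous_SUN hLPc₀ _), hIBP, hLap0, add_zero]
  exact hmain.congr_deriv hval

end SUNBakryEmery

end Literature.MathematicalPhysics.QuantumFieldTheory
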